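import Summits.QuantumFields.YangMills.Theorems.BalabanUVNodesN07AtRecord11

/-!
# BalabanUVNodes ∕ N07 ([B11]) — THE RESTRICTION LAW OF THE DICTIONARY AT NODE 00's OBJECTS: [Balaban1985Variational] Theorem 1 over the Theorem-1
# family of record from Proposition 7, Proposition 8, Sect. F and «minimal ⇒ critical» ONLY — the residual clause `hloc` (local-minimum half of
# `B11.VarProblemX.Laws` (iii), DIVERGENCE D-B11-2) displayed by every N07 closer at the record is ELIMINABLE there

Track A of `YM-PLAN.md` (cell `pub-ymgap`, HUMAN RULING D-0062), node **N07** = [Balaban1985Variational] Thm 1 p. 279 + Props 2–9 pp. 281–309; seat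
`pub-ymgap-dag-n07-e` (generation 0; director-ym R141 (C) WIDER STRATEGY FAN-OUT, `FAN-OUT.md` v1.1 §N07 row s3 «… the located caveat»), second module,
finding F-n07e-1 of the seat.  THEOREMS ONLY (0 `def`, 0 `sorry`, standard axioms); COUNT-NEUTRAL; `--supports stmt-QuantumFields-19674` (K1 `StabilityBAtRecordR11e`).
Imports n07-a g4's `BalabanUVNodesN07AtRecord11` (p450629) and through it `BalabanUVNodesN07AtRecordCarriersZ` (p433511), `Node00/Record11Carriers`, `Node00/CarriersZ`,
r2's `B11` and r08's `B11SectFAssembly`; nothing there is modified.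

T. Bałaban, *The variational problem and background fields in renormalization group method for lattice gauge theories*, Commun. Math. Phys. **102**
(1985) 277–309 [Balaban1985Variational]; p. 304 [PDF 28], verbatim: *«We have constructed the minimal configuration U_k in the space (2) with ε₀ = O(1)B₃ε₁,
hence we have the additional restriction on ε₁: O(1)B₃ε₁ ≤ a₅. Now we define a₁ as a largest constant such, that the restriction ε₁ ≤ a₁ implies all the other
restrictions we have imposed on ε₁. Especially it implies that U_k is in the space (8).»*; p. 299 [PDF 23], verbatim: *«A second order differential at A′ = 0
… is positive definite. Hence A′ = 0 is a minimum»* (the LOCAL-minimum step — inside the proof of Proposition 7, i.e. inside `B11Prop7Assembly.ExistenceLeavesCap`).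

THE FINDING (F-n07e-1).  r2's dictionary `B11.VarProblemX.Laws` (iii) reads «a configuration on a minimal orbit in 𝔘_k(e′) ∩ 𝔅_k(V) which lies in 𝔘_k(e) is on a
minimal orbit in 𝔘_k(e) ∩ 𝔅_k(V)» for ALL `e, e′`.  n07-a split it at NODE 00's objects (`laws_famXOfRecord`, p433511): for `e ≤ e′` a THEOREM (a minimiser over a
larger class lying in a smaller class minimises there), for `e′ < e` a DISPLAYED residual `hloc` — carried since by `b11Leaf_Z11OfRecord_of_parts` (p433511),
`thm1Printed_Z11OfRecord_of_prop7_leaves` ∕ `b11Leaf_Z11OfRecord_of_prop7_leaves` ∕ `exists_record₁₁CB10YZW_b11_main_of_prop7_leaves` (p450629) and by the `lawsA`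
binder of the scale towers.  But law (iii) is CONSUMED by every knit in the tree exactly once (`B11.thm1_of_prop7_prop8_sectF`, `B11Thm1.thm1_clauses_of_background`:
`Lrestr _ _ V U hU h8U`), at `e = B₃ε₁`, `e′ = O₁C₁B₃ε₁`, `O₁` = Proposition 7 (ii)'s «O(1)».  If `O₁C₁ ≥ 1` this is the provable direction.  If `O₁C₁ < 1` (the typed
`B11.Prop7Printed` only asks `0 < O₁`) law (iii) is not needed either: AT OBJECTS (7) = `PlaqSmall` is monotone in `ε₁`, so Proposition 7 (ii) applied to the SAME `V` at
`ε₁′ := ε₁ ∕ m`, `m := min{1, O₁C₁}`, yields the minimal orbit in `𝔘((O₁C₁∕m)B₃ε₁) ⊇ 𝔘(B₃ε₁)`, Proposition 8 (at `ε₀ = (O₁C₁∕m)B₃ε₁ ≤ a₅`) places it in `𝔘(B₃ε₁)`, and the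
provable restriction finishes; the price is `a₁ ↦ min{m·a′₁, a₁(F), m·a₅∕(O₁C₁B₃), a₀∕B₃}` (print: `O(1)·C₁ = O(1)·L³ ≥ 1`, `m = 1`, no price).  So THEOREM 1 OVER THE WHOLE FAMILY
OF RECORD follows from Props 7, 8, Sect. F and the ONE residual dictionary clause `hcrit` («minimal ⇒ critical» for the layer's criticality predicate `ζ.IsCrit`) —
`hloc` is gone.  As a ∀-sentence over all radii `hloc` is not printed (print's local-minimum step lives inside Prop 7's proof and stays in `ExistenceLeavesCap.minimal142`)
and at `k ≥ 1` it is not expected to hold at objects (sup-norm-constrained versus action minimisers), so removing it from the closers is a repair, not a cosmetic.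

CONTENT.
* §1 `onMinimalOrbit_restrict_of_le` (law (iii) for `e ≤ e′` at the carrier `varProblemT`, by n07-a's `isBackground_of_subset_of_mem` + `inUkClassB11_mono`),
  `reg7_mono_record` ((7) monotone in `ε₁` at the carrier).
* §2 **`exists_thm1At_famV_of_prop7_prop8_sectF`**: ONE block of constants `C` with `B11Thm1.Thm1At C` at EVERY member of `Node00.famVOfRecord F N ζ` from
  `B11.Prop7Printed ζ.B₃ ζ.C₁ (famXOfRecord F N ζ)`, `B11.Prop8Printed ζ.B₃ …`, `B11.SectFPrinted ζ.B₃ …`, `0 < ζ.B₃`, `0 < ζ.C₁` and `hcrit` — r2's p.-304 assembly re-run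
  at objects with the rescaling above; `thm1Printed_Z11OfRecord_of_prop7_prop8_sectF` (the `B11.Thm1Printed (Z11OfRecord F N ζ).famV` form).
* §3 THE `hloc`-FREE TWINS of the landed closers (same displayed inputs minus `hloc`, proofs by name): `thm1Printed_Z11OfRecord_of_prop7_leaves_noLoc`,
  `b11Leaf_Z11OfRecord_of_parts_noLoc`, `b11Leaf_Z11OfRecord_of_prop7_leaves_noLoc`, `exists_record₁₁CB10YZW_b11_main_of_prop7_leaves_noLoc`.

HONEST FRAMING.  Kernel bookkeeping at NODE 00's no-holes objects; ONE displayed non-printed hypothesis removed from the N07 pin list, none added (a threshold shrinks);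
NOTHING of Sects. B–G proved; [B11] Theorem 1 for `k ≥ 1` enters nowhere as a conclusion except from the displayed Props 7, 8, Sect. F (resp. Prop 7 + the Sect.-F
leaves); `hcrit` stays displayed (it reads the residual predicate `ζ.IsCrit`); N07 NOT discharged; counts 5∕27 unmoved; no object of record modified; one finite
four-torus programme at fixed `ε` — NOT continuum ∕ ℝ⁴ ∕ infinite volume ∕ OS ∕ mass gap ∕ Clay.  No `def`, no `instance`, no `notation`.
-/

noncomputable section

namespace Summit.QuantumFields.YangMills.BalabanUVNodes.N07RestrictionLawAtObjects

open Literature.MathematicalPhysics.QuantumFieldTheory.Balaban1983to89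
open Literature.MathematicalPhysics.QuantumFieldTheory.Balaban1983to89.T4Continuum (T4Family FiniteEpsData)
open Literature.MathematicalPhysics.QuantumFieldTheory.Balaban1983to89.DagBinding
open Literature.MathematicalPhysics.QuantumFieldTheory.Balaban1983to89.Node00
open Literature.MathematicalPhysics.QuantumFieldTheory.Balaban1983to89.B11Thm1 (Thm1At Exists8 Unique6 Reg910)
open Literature.MathematicalPhysics.QuantumFieldTheory.Balaban1983to89.B11Thm1CarrierT (RegCarrierT varProblemT)
open Literature.MathematicalPhysics.QuantumFieldTheory.Balaban1983to89.B11SectFAssembly (CubeData Leaves)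
open Literature.MathematicalPhysics.QuantumFieldTheory.Balaban1983to89.B12GaugeOrbits021 (OrbitRel)
open Summit.QuantumFields.YangMills.BalabanUVNodes.N07AtRecord11 (exists_record₁₁CB10YZW_b11_main_iff_leaf)
open scoped Matrix.Norms.L2Operator

variable {F : T4Family} {N : ℕ} [NeZero N]

/-! ## §1 The two dictionary facts that ARE theorems at the carrier: restriction for `e ≤ e′`, monotonicity of (7) -/

/-- **LAW (iii) FOR `e ≤ e′` AT NODE 00's OBJECTS**: a configuration on a minimal orbit of (5) in `𝔘_k(e′) ∩ 𝔅_k(V)` which lies in `𝔘_k(e)`, `e ≤ e′`, is on a minimal orbit in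
`𝔘_k(e) ∩ 𝔅_k(V)` (a minimiser over a larger class lying in a smaller class minimises there: n07-a's `isBackground_of_subset_of_mem` with `inUkClassB11_mono`).  This is
the ONLY instance of law (iii) the knits consume when `O(1)·C₁ ≥ 1`. [cite: Balaban1985Variational, (2), (5)–(6) p.278; p.304 («Especially it implies that U_k is in the space (8)»)] -/
theorem onMinimalOrbit_restrict_of_le {K k : ℕ} (R : RegCarrierT F N K) {e e' : ℝ} (hle : e ≤ e') {V : GaugeField (F.P K) k (SU N)}
    {U : GaugeField (F.P K) 0 (SU N)} (h : (varProblemT F N K k R).OnMinimalOrbit e' V U) (hIn : (varProblemT F N K k R).InU e U) :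
    (varProblemT F N K k R).OnMinimalOrbit e V U :=
  B11Thm1CarrierT.isBackground_of_subset_of_mem h
    (fun U' (hU' : InUkClassB11 F N K k e U') => B11Thm1CarrierTLevelZero.inUkClassB11_mono hle hU') hIn

/-- **(7) IS MONOTONE IN `ε₁` AT NODE 00's OBJECTS** (`PlaqSmall`: strict plaquette bounds; no such law is part of the abstract carrier `B11.VarProblem`, which is why
r2's knit reaches for law (iii) instead). [cite: Balaban1985Variational, (7) p.278] -/
theorem reg7_mono_record {K k : ℕ} (R : RegCarrierT F N K) {ε ε' : ℝ} (hle : ε ≤ ε') {V : GaugeField (F.P K) k (SU N)}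
    (h : (varProblemT F N K k R).Reg7 ε V) : (varProblemT F N K k R).Reg7 ε' V :=
  fun p => (h p).trans_le hle

/-! ## §2 Theorem 1 over the family of record from Props 7, 8, Sect. F and «minimal ⇒ critical» only -/

section Knit

variable (ζ : ResidZ F N)

/-- **THEOREM 1 AT ONE BLOCK OF CONSTANTS OVER THE WHOLE THEOREM-1 FAMILY OF RECORD ⇐ PROPOSITIONS 7, 8, SECT. F and `hcrit`** — r2's p.-304 assembly
(`B11.thm1_of_prop7_prop8_sectF`) RE-RUN AT NODE 00's OBJECTS WITHOUT the restriction law's local-minimum half: with `m := min{1, O₁C₁}` and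
`a₁ := min{m·a′₁, a₁(F), m·a₅∕(O₁C₁B₃), a₀∕B₃}`, for `0 < ε₁ ≤ a₁` and `V` with (7) Proposition 7 (ii) is applied at `ε₁′ = ε₁∕m ≥ ε₁` ((7) monotone), giving a minimal orbit
in `𝔘((O₁C₁∕m)B₃ε₁)`, `(O₁C₁∕m)B₃ε₁ ≥ B₃ε₁`; Proposition 8 at `ε₀ = (O₁C₁∕m)B₃ε₁ ≤ a₅` puts it in `𝔘(B₃ε₁)`; restriction for `e ≤ e′` gives (8); uniqueness in (6) is
Proposition 7 (i) read through `hcrit` at both radii; (9)–(10) is Sect. F with `M(ε₁) = R₁M₁·(a₁∕ε₁)`.  Output constants `(a₀, a₁, ζ.B₃, B₄, M(·))`, `B₃a₁ ≤ a₀`.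
[cite: Balaban1985Variational, Thm 1 p.279; Prop. 7 p.299; Prop. 8 p.304; p.304 («Now we define a₁ …»); Sect. F (169) p.305] -/
theorem exists_thm1At_famV_of_prop7_prop8_sectF (hB₃ : 0 < ζ.B₃) (hC₁ : 0 < ζ.C₁)
    (hcrit : ∀ (i : ZIdx) (e : ℝ) (V : GaugeField (F.P i.K) i.k (SU N)) (U : GaugeField (F.P i.K) 0 (SU N)),
      IsBackground (avOfRecord F N i.K) {U | InUkClassB11 F N i.K i.k e U} i.k V U → ζ.IsCrit i V U)
    (p7 : B11.Prop7Printed ζ.B₃ ζ.C₁ (famXOfRecord F N ζ)) (p8 : B11.Prop8Printed ζ.B₃ (famXOfRecord F N ζ))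
    (sF : B11.SectFPrinted ζ.B₃ (famXOfRecord F N ζ)) :
    ∃ C : B11Thm1.Consts, C.B₃ = ζ.B₃ ∧ ∀ i : ZIdx, Thm1At C (famVOfRecord F N ζ i) := by
  obtain ⟨a₀, a₁', O₁, ha₀, ha₁', hO₁, H7⟩ := p7
  obtain ⟨a₅, ha₅, H8⟩ := p8
  obtain ⟨aF, B₄, RM, haF, hB₄, hRM, HF⟩ := sF
  -- the rescaling factor `m = min{1, O₁C₁}` and the radius factor `O₁C₁/m ≥ 1`
  set m : ℝ := min 1 (O₁ * ζ.C₁) with hmdef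
  have hOC : 0 < O₁ * ζ.C₁ := mul_pos hO₁ hC₁
  have hm : 0 < m := lt_min one_pos hOC
  have hm1 : m ≤ 1 := min_le_left _ _
  have hmO : m ≤ O₁ * ζ.C₁ := min_le_right _ _
  have hK : 0 < O₁ * ζ.C₁ * ζ.B₃ := mul_pos hOC hB₃
  have hrad : 1 ≤ O₁ * ζ.C₁ / m := (one_le_div hm).2 hmO
  -- the final `a₁` (p. 304), shrunk by `m`
  set a₁ : ℝ := min (min (m * a₁') aF) (min (m * a₅ / (O₁ * ζ.C₁ * ζ.B₃)) (a₀ / ζ.B₃)) with ha₁def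
  have ha₁pos : 0 < a₁ := by
    simp only [ha₁def, lt_min_iff]
    exact ⟨⟨mul_pos hm ha₁', haF⟩, div_pos (mul_pos hm ha₅) hK, div_pos ha₀ hB₃⟩
  have h1 : a₁ ≤ m * a₁' := le_trans (min_le_left _ _) (min_le_left _ _)
  have h2 : a₁ ≤ aF := le_trans (min_le_left _ _) (min_le_right _ _)
  have h3 : a₁ ≤ m * a₅ / (O₁ * ζ.C₁ * ζ.B₃) := le_trans (min_le_right _ _) (min_le_left _ _)
  have h4 : a₁ ≤ a₀ / ζ.B₃ := le_trans (min_le_right _ _) (min_le_right _ _)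
  have hB₃a₁ : ζ.B₃ * a₁ ≤ a₀ := by
    have := (le_div_iff₀ hB₃).1 h4
    linarith [mul_comm ζ.B₃ a₁]
  refine ⟨⟨a₀, a₁, ζ.B₃, B₄, fun e => RM * (a₁ / e), ha₀, ha₁pos, hB₃, hB₄, hB₃a₁, fun e he => by positivity⟩, rfl, ?_⟩
  intro i ε₁ hε₁ hε₁a V hV
  -- «minimal ⇒ critical ∧ in the space» (law (ii) at objects from `hcrit`)
  have Lmin : ∀ (e : ℝ) (U : GaugeField (F.P i.K) 0 (SU N)), (famVOfRecord F N ζ i).OnMinimalOrbit e V U →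
      ζ.IsCrit i V U ∧ (famVOfRecord F N ζ i).InU e U ∧ (famVOfRecord F N ζ i).InB V U :=
    fun e U hU => ⟨hcrit i e V U hU, hU.2.1, hU.1⟩
  -- EXISTENCE (8): Prop 7 (ii) at `ε₁' = ε₁/m`, Prop 8, restriction for `e ≤ e′`
  have hε₁' : 0 < ε₁ / m := div_pos hε₁ hm
  have hε₁le : ε₁ ≤ ε₁ / m := by
    rw [le_div_iff₀ hm]
    exact mul_le_of_le_one_right hε₁.le hm1
  have hε₁'a : ε₁ / m ≤ a₁' := by
    rw [div_le_iff₀ hm]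
    linarith [mul_comm m a₁']
  have hV' : (famXOfRecord F N ζ i).Reg7 (ε₁ / m) V := reg7_mono_record (ζ.R i) hε₁le hV
  have hex : Exists8 (famVOfRecord F N ζ i) ζ.B₃ ε₁ V := by
    obtain ⟨U, hU⟩ := (H7 i a₀ (ε₁ / m) hε₁' V hV').2 hε₁'a
    obtain ⟨hc, hIn, hB⟩ := Lmin _ U hU
    -- the radius of Prop 7's orbit dominates `B₃ε₁` and stays below `a₅`
    have hrad' : ζ.B₃ * ε₁ ≤ O₁ * ζ.C₁ * ζ.B₃ * (ε₁ / m) := by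
      have e1 : O₁ * ζ.C₁ * ζ.B₃ * (ε₁ / m) = (O₁ * ζ.C₁ / m) * (ζ.B₃ * ε₁) := by
        field_simp
      rw [e1]
      exact le_mul_of_one_le_left (by positivity) hrad
    have hε₀a₅ : O₁ * ζ.C₁ * ζ.B₃ * (ε₁ / m) ≤ a₅ := by
      have hKa : a₁ * (O₁ * ζ.C₁ * ζ.B₃) ≤ m * a₅ := (le_div_iff₀ hK).1 h3
      have hmon : O₁ * ζ.C₁ * ζ.B₃ * ε₁ ≤ O₁ * ζ.C₁ * ζ.B₃ * a₁ := mul_le_mul_of_nonneg_left hε₁a hK.le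
      rw [show O₁ * ζ.C₁ * ζ.B₃ * (ε₁ / m) = (O₁ * ζ.C₁ * ζ.B₃ * ε₁) / m by ring, div_le_iff₀ hm]
      linarith [mul_comm a₁ (O₁ * ζ.C₁ * ζ.B₃), mul_comm m a₅]
    have h8U : (famVOfRecord F N ζ i).InU (ζ.B₃ * ε₁) U := H8 i _ ε₁ hε₁ V U hV hIn hB hc hε₀a₅
    exact ⟨U, h8U, hB, onMinimalOrbit_restrict_of_le (ζ.R i) hrad' hU h8U⟩
  refine ⟨hex, ?_, ?_⟩
  · -- UNIQUENESS in (6): Prop 7 (i) at `ε₀`, both minimisers critical by `hcrit`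
    intro ε₀ hlo hhi U hU
    obtain ⟨hc, hIn, hB⟩ := Lmin _ U hU
    have hIn0 : (famVOfRecord F N ζ i).InU ε₀ U := B11Thm1CarrierTLevelZero.inUkClassB11_mono hlo hIn
    have hAM := (H7 i ε₀ ε₁ hε₁ V hV).1 hhi hlo
    refine ⟨hIn0, hB, fun U' hU' => ?_⟩
    obtain ⟨hc', hIn', hB'⟩ := Lmin ε₀ U' hU'
    exact hAM U U' hIn0 hB hc hIn' hB' hc'
  · -- REGULARITY (9)–(10): Sect. F for cubes with `M ≤ R₁M₁(a₁/ε₁) ≤ R₁M₁(a₁(F)/ε₁)`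
    intro U hU c hc
    obtain ⟨hcrit', hIn, hB⟩ := Lmin _ U hU
    have hcF : (famVOfRecord F N ζ i).sizeM c ≤ RM * (aF / ε₁) := by
      refine le_trans hc ?_
      have : a₁ / ε₁ ≤ aF / ε₁ := div_le_div_of_nonneg_right h2 hε₁.le
      exact mul_le_mul_of_nonneg_left this hRM.le
    exact HF i ε₁ V U hε₁ (le_trans hε₁a h2) hV hIn hB hcrit' c hcF

/-- **… as `B11.Thm1Printed` over the bundle of record's Theorem-1 family** (`(Z11OfRecord F N ζ).famV`; n07-a's `thm1Printed_iff_thm1At`).  The `t1` conjunct of the leaf from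
Props 7, 8, Sect. F and `hcrit`, NO `hloc`. [cite: Balaban1985Variational, Thm 1 p.279, Props 7–8 pp.299–304, Sect. F p.305] -/
theorem thm1Printed_Z11OfRecord_of_prop7_prop8_sectF (hB₃ : 0 < ζ.B₃) (hC₁ : 0 < ζ.C₁)
    (hcrit : ∀ (i : ZIdx) (e : ℝ) (V : GaugeField (F.P i.K) i.k (SU N)) (U : GaugeField (F.P i.K) 0 (SU N)),
      IsBackground (avOfRecord F N i.K) {U | InUkClassB11 F N i.K i.k e U} i.k V U → ζ.IsCrit i V U)
    (p7 : B11.Prop7Printed ζ.B₃ ζ.C₁ (famXOfRecord F N ζ)) (p8 : B11.Prop8Printed ζ.B₃ (famXOfRecord F N ζ))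
    (sF : B11.SectFPrinted ζ.B₃ (famXOfRecord F N ζ)) : B11.Thm1Printed (Z11OfRecord F N ζ).famV := by
  obtain ⟨C, -, hC⟩ := exists_thm1At_famV_of_prop7_prop8_sectF ζ hB₃ hC₁ hcrit p7 p8 sF
  exact (B11Thm1CarrierT.thm1Printed_iff_thm1At (fun i : ZIdx => i.K) (fun i => i.k) ζ.R).2 ⟨C, hC⟩

/-! ## §3 The `hloc`-free twins of the landed closers -/

/-- **THEOREM 1 OVER THE FAMILY OF RECORD ⇐ PROPOSITION 7 ∧ THE LOCATED LEAVES OF SECT. F ∧ `hcrit`** — p450629's `thm1Printed_Z11OfRecord_of_prop7_leaves` WITHOUT `hloc`: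
Prop 8 by `B11SectFAssembly.prop8Printed_of_leaves` (needs only the monotonicity of (2), a theorem), the Sect. F conclusion by `sectFPrinted_of_leaves`, then §2.
[cite: Balaban1985Variational, Thm 1 p.279, Prop. 7 p.299, Prop. 8 p.304, Sect. F (144)–(169) pp.300–305] -/
theorem thm1Printed_Z11OfRecord_of_prop7_leaves_noLoc (Dc : ∀ i : ZIdx, CubeData (famXOfRecord F N ζ i))
    {d L B₁ B₂ K R₁M₁ c₁ a₃ a₄ : ℝ} (hLv : ∀ i, Leaves (famXOfRecord F N ζ i) (Dc i) d L B₁ B₂ ζ.B₃ K R₁M₁ c₁ a₃ a₄)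
    (hd : 1 ≤ d) (hL : 0 < L) (hB₁ : 0 < B₁) (hB₂ : 0 < B₂) (hB₃ : 0 < ζ.B₃) (hK : 0 < K) (hR : 1 ≤ R₁M₁) (hc₁ : 0 < c₁) (ha₃ : 0 < a₃)
    (ha₄ : 0 < a₄) (hC₁ : 0 < ζ.C₁)
    (hcrit : ∀ (i : ZIdx) (e : ℝ) (V : GaugeField (F.P i.K) i.k (SU N)) (U : GaugeField (F.P i.K) 0 (SU N)),
      IsBackground (avOfRecord F N i.K) {U | InUkClassB11 F N i.K i.k e U} i.k V U → ζ.IsCrit i V U)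
    (p7 : B11.Prop7Printed ζ.B₃ ζ.C₁ (famXOfRecord F N ζ)) : B11.Thm1Printed (Z11OfRecord F N ζ).famV :=
  thm1Printed_Z11OfRecord_of_prop7_prop8_sectF ζ hB₃ hC₁ hcrit p7
    (B11SectFAssembly.prop8Printed_of_leaves (famXOfRecord F N ζ) Dc hLv hd hL hB₁ hB₃ hK (by linarith) hc₁ ha₃ ha₄
      fun i _ _ _ hle hU => B11Thm1CarrierTLevelZero.inUkClassB11_mono hle hU)
    (B11SectFAssembly.sectFPrinted_of_leaves (famXOfRecord F N ζ) Dc hLv (by linarith) hL hB₁ hB₂ hB₃ hK hR hc₁ ha₃ ha₄)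

/-- **THE [B11] LEAF AT THE BUNDLE OF RECORD FROM THE NINE PRINTED PARTS AND `hcrit`** — p433511's `b11Leaf_Z11OfRecord_of_parts` WITHOUT `hloc`: `t1` by §2 from `p7 p8 sF`.
[cite: Balaban1985Variational, Thm 1 p.279, Props 2–9 pp.281–309] -/
theorem b11Leaf_Z11OfRecord_of_parts_noLoc (hB₃ : 0 < ζ.B₃) (hC₁ : 0 < ζ.C₁)
    (hcrit : ∀ (i : ZIdx) (e : ℝ) (V : GaugeField (F.P i.K) i.k (SU N)) (U : GaugeField (F.P i.K) 0 (SU N)),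
      IsBackground (avOfRecord F N i.K) {U | InUkClassB11 F N i.K i.k e U} i.k V U → ζ.IsCrit i V U)
    (p2 : B11.Prop2Printed ζ.B₁ ζ.B₃ ζ.C₁ ζ.c₁ ζ.famLG) (p3 : B11.Prop3Printed ζ.C₁ ζ.B₃ ζ.C₂ ζ.C₃ ζ.B₀ ζ.c1h ζ.c₄ ζ.δ₀ ζ.famLG)
    (p4 : B11.Prop4Printed ζ.C₁ ζ.B₃ ζ.famLG) (p5 : B11.Prop5Printed ζ.B₁ ζ.B₃ ζ.C₁ ζ.famLG) (p6 : B11.Prop6Printed ζ.B₀ ζ.B₃ ζ.C₁ ζ.famLG)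
    (p7 : B11.Prop7Printed ζ.B₃ ζ.C₁ (famXOfRecord F N ζ)) (p8 : B11.Prop8Printed ζ.B₃ (famXOfRecord F N ζ))
    (sF : B11.SectFPrinted ζ.B₃ (famXOfRecord F N ζ)) (p9 : B11.Prop9Printed ζ.B₅ ζ.C₁ ζ.β₀ ζ.δ₀ ζ.famAn) :
    B11Leaf (Z11OfRecord F N ζ) where
  t1 := thm1Printed_Z11OfRecord_of_prop7_prop8_sectF ζ hB₃ hC₁ hcrit p7 p8 sF
  p2 := p2
  p3 := p3
  p4 := p4
  p5 := p5
  p6 := p6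
  p7 := p7
  p8 := p8
  sF := sF
  p9 := p9

/-- **THE [B11] LEAF AT THE BUNDLE OF RECORD FROM PROPS 2–7, 9, THE LOCATED LEAVES OF SECT. F AND `hcrit`** — p450629's `b11Leaf_Z11OfRecord_of_prop7_leaves` WITHOUT `hloc`.
[cite: Balaban1985Variational, Thm 1 p.279, Props 2–9 pp.281–309, Sect. F (144)–(169) pp.300–305] -/
theorem b11Leaf_Z11OfRecord_of_prop7_leaves_noLoc (Dc : ∀ i : ZIdx, CubeData (famXOfRecord F N ζ i)) {d L B₂ K R₁M₁ a₃ a₄ : ℝ}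
    (hLv : ∀ i, Leaves (famXOfRecord F N ζ i) (Dc i) d L ζ.B₁ B₂ ζ.B₃ K R₁M₁ ζ.c₁ a₃ a₄)
    (hd : 1 ≤ d) (hL : 0 < L) (hB₂ : 0 < B₂) (hK : 0 < K) (hR : 1 ≤ R₁M₁) (ha₃ : 0 < a₃) (ha₄ : 0 < a₄)
    (hB₁ : 0 < ζ.B₁) (hB₃ : 0 < ζ.B₃) (hC₁ : 0 < ζ.C₁) (hc₁ : 0 < ζ.c₁)
    (hcrit : ∀ (i : ZIdx) (e : ℝ) (V : GaugeField (F.P i.K) i.k (SU N)) (U : GaugeField (F.P i.K) 0 (SU N)),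
      IsBackground (avOfRecord F N i.K) {U | InUkClassB11 F N i.K i.k e U} i.k V U → ζ.IsCrit i V U)
    (p2 : B11.Prop2Printed ζ.B₁ ζ.B₃ ζ.C₁ ζ.c₁ ζ.famLG) (p3 : B11.Prop3Printed ζ.C₁ ζ.B₃ ζ.C₂ ζ.C₃ ζ.B₀ ζ.c1h ζ.c₄ ζ.δ₀ ζ.famLG)
    (p4 : B11.Prop4Printed ζ.C₁ ζ.B₃ ζ.famLG) (p5 : B11.Prop5Printed ζ.B₁ ζ.B₃ ζ.C₁ ζ.famLG) (p6 : B11.Prop6Printed ζ.B₀ ζ.B₃ ζ.C₁ ζ.famLG)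
    (p7 : B11.Prop7Printed ζ.B₃ ζ.C₁ (famXOfRecord F N ζ)) (p9 : B11.Prop9Printed ζ.B₅ ζ.C₁ ζ.β₀ ζ.δ₀ ζ.famAn) :
    B11Leaf (Z11OfRecord F N ζ) :=
  b11Leaf_Z11OfRecord_of_parts_noLoc ζ hB₃ hC₁ hcrit p2 p3 p4 p5 p6 p7
    (B11SectFAssembly.prop8Printed_of_leaves (famXOfRecord F N ζ) Dc hLv hd hL hB₁ hB₃ hK (by linarith) hc₁ ha₃ ha₄
      fun i _ _ _ hle hU => B11Thm1CarrierTLevelZero.inUkClassB11_mono hle hU)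
    (B11SectFAssembly.sectFPrinted_of_leaves (famXOfRecord F N ζ) Dc hLv (by linarith) hL hB₁ hB₂ hB₃ hK hR hc₁ ha₃ ha₄) p9

end Knit

/-- **THE STAGE-11 CONSUMER, END TO END, WITHOUT `hloc`** — p450629's `exists_record₁₁CB10YZW_b11_main_of_prop7_leaves` minus `hloc`: Props 2–7, 9 + the located leaves of Sect. F
+ `hcrit` at a residual [B11] layer `ζ` ⇒ N07 HOLDS at every run of a ₁₁CB10YZW record over `datumOfRecord₁₁ θ h` (junk-ops presentation; NOT a discharge).
[cite: Balaban1985Variational, Thm 1 p.279, Props 2–9 pp.281–309, Sect. F pp.300–305] -/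
theorem exists_record₁₁CB10YZW_b11_main_of_prop7_leaves_noLoc (θ : Stage11Params F N) (h : θ.Provisos₁₁) (hθ : θ.Admissible)
    (hγ : 0 < θ.γ) (Mstar : ℕ) (lamW : ResidW F N) (ζ : ResidZ F N) (Dc : ∀ i : ZIdx, CubeData (famXOfRecord F N ζ i))
    {d L B₂ K R₁M₁ a₃ a₄ : ℝ} (hLv : ∀ i, Leaves (famXOfRecord F N ζ i) (Dc i) d L ζ.B₁ B₂ ζ.B₃ K R₁M₁ ζ.c₁ a₃ a₄)
    (hd : 1 ≤ d) (hL : 0 < L) (hB₂ : 0 < B₂) (hK : 0 < K) (hR : 1 ≤ R₁M₁) (ha₃ : 0 < a₃) (ha₄ : 0 < a₄)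
    (hB₁ : 0 < ζ.B₁) (hB₃ : 0 < ζ.B₃) (hC₁ : 0 < ζ.C₁) (hc₁ : 0 < ζ.c₁)
    (hcrit : ∀ (i : ZIdx) (e : ℝ) (V : GaugeField (F.P i.K) i.k (SU N)) (U : GaugeField (F.P i.K) 0 (SU N)),
      IsBackground (avOfRecord F N i.K) {U | InUkClassB11 F N i.K i.k e U} i.k V U → ζ.IsCrit i V U)
    (p2 : B11.Prop2Printed ζ.B₁ ζ.B₃ ζ.C₁ ζ.c₁ ζ.famLG) (p3 : B11.Prop3Printed ζ.C₁ ζ.B₃ ζ.C₂ ζ.C₃ ζ.B₀ ζ.c1h ζ.c₄ ζ.δ₀ ζ.famLG)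
    (p4 : B11.Prop4Printed ζ.C₁ ζ.B₃ ζ.famLG) (p5 : B11.Prop5Printed ζ.B₁ ζ.B₃ ζ.C₁ ζ.famLG) (p6 : B11.Prop6Printed ζ.B₀ ζ.B₃ ζ.C₁ ζ.famLG)
    (p7 : B11.Prop7Printed ζ.B₃ ζ.C₁ (famXOfRecord F N ζ)) (p9 : B11.Prop9Printed ζ.B₅ ζ.C₁ ζ.β₀ ζ.δ₀ ζ.famAn) :
    ∃ w : WorldP, IsRecordOfRecord₁₁CB10YZW F N (datumOfRecord₁₁ F N θ h) w ∧ ∀ P : B12.RunParams, Dag.B11_main (leavesP w P) := by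
  obtain ⟨w, hw, hl⟩ := exists_record₁₁CB10YZW_b11_main_iff_leaf θ h hθ hγ Mstar ζ lamW
  exact ⟨w, hw, fun P => (hl P).2 (b11Leaf_Z11OfRecord_of_prop7_leaves_noLoc ζ Dc hLv hd hL hB₂ hK hR ha₃ ha₄ hB₁ hB₃ hC₁ hc₁ hcrit
    p2 p3 p4 p5 p6 p7 p9)⟩

end Summit.QuantumFields.YangMills.BalabanUVNodes.N07RestrictionLawAtObjects

end
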